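import Mathlib
import Summits.NavierStokesRegularity.NavierStokesRegularity.Theorems.TaoLadderRungTwoBreakBlowupRigidityOneMixedDrainPairViscousTransmission
import Summits.NavierStokesRegularity.NavierStokesRegularity.Theorems.TaoLadderRungTwoBreakBlowupRigidityOneSubcriticalCeiling
import Summits.NavierStokesRegularity.NavierStokesRegularity.Theorems.TaoLadderRungTwoBreakBlowupRigidityOneMaximalExactFlow
import HarnessLib

/-!
# ROBUST BLOW-UP OF `M(u,v)` NEEDS WAKES LOADED AT THE SURVIVING RATE on every small-viscosity companion: if
  `NoGlobalCascade ε₀ M(u,v) X₀`, then along the maximal `ν̂`-viscous flow (every `0 < ν̂ ≤ κ/√2`) the time-integrated wake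
  energies `∫₀ᵗ b_k²` admit NO geometric envelope `W σ^k` with `(1+ε₀)(Λσ)² < 1` — the viscous transmission law
  (`…MixedDrainPairViscousTransmission`) turns such an envelope into the sub-(S₁) amplitude ceiling `‖x_j‖ ≤ B(Λσ)^j`
  excluded by `weight45_bounded_of_subcriticalCeiling` (`…SubcriticalCeiling`).  Census item (MP′) of K2(1)
  `TaoLadderRungTwoBreak.BlowupRigidityOne` (stmt-NavierStokesRegularity-20206; `--supports`) in ONE scalar sequence:
  (MP′) ⟸ «for some small ν̂ the companion's wakes satisfy ∫₀ᵗ b_k² ≤ W σ^k with σ < (1+ε₀)^{−1/2}Λ^{−1} = (1+ε₀)^{−3}».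

MODEL lattice ODEs only (Tao 2016 §4: the NS-scaled viscous lattice before Thm. 4.2, Thm. 4.2 statement shape, Lemma 4.1
(4.5)); nothing here is a statement about the Navier–Stokes equations; NO item is closed.  DEF-FREE; ROUTE-INDEPENDENT.
NUMERICAL CONTEXT (census #60): the inviscid fronts of `M(u,v)` are sub-surviving (`μ ≈ Λ^{−1.1…−1.5}`) and the viscous
companions stall, so the envelope is expected to hold with room to spare; it is NOT proved here.

* `wakeLoading_of_noGlobalCascade_visc_mixedDrainPair` — the statement above (`0 < |u|, |v| ≤ 1`).

HONEST LABEL: a necessary condition for robust blow-up on one explicit table family; no stub, crux, rung or summit is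
proved; rung 0.
-/

noncomputable section

-- the summit and its single sub-problem share the name (CONVENTIONS §1)
set_option linter.dupNamespace false

open Set Filter Topology MeasureTheory
open scoped RealInnerProductSpace

namespace Summit.NavierStokesRegularity.NavierStokesRegularity.Theorems

namespace BlowupRigidityOne

open Literature.Analysis.FluidPDE Literature.Analysis.FluidPDE.TaoCascade

/-- **ROBUST BLOW-UP OF `M(u,v)` ⇒ WAKES LOADED AT THE SURVIVING RATE on every small-viscosity companion.**  Let
`0 < |u|, |v| ≤ 1` (so `M(u,v) ∈ E₂(max |u|⁻¹ |v|⁻¹)`) and `NoGlobalCascade ε₀ M(u,v) X₀`.  Then there is `κ > 0` such that for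
every viscosity `0 < ν̂ ≤ κ/√2` the maximal `ν̂`-viscous flow `X` from `X₀` at shell `0` (on `[0,T)`) has the property: for all
`W` and all `σ > 0` with `(1+ε₀)(Λσ)² < 1` some shell `k ≥ 1` and time `t < T` satisfy `W σ^k < ∫₀ᵗ b_k(s)² ds`.
(Otherwise `‖x_{k+1}(t)‖ ≤ 2|u/v|√(u²+v²) Λ^k W σ^k` by the viscous transmission law and `‖x_0‖, ‖x_1‖ ≤ √E₀` give the
ceiling `‖x_j‖ ≤ B (Λσ)^j`, under which `weight45_bounded_of_subcriticalCeiling` bounds the (4.5) norm — against the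
blow-up of the maximal flow.)
[cite: Tao2016AveragedNS, §4 Thm. 4.2 (statement shape), the viscous equation before Thm. 4.2, Lemma 4.1 (4.5); cell vocabulary (`NoGlobalCascade`, census item (MP′))] -/
theorem wakeLoading_of_noGlobalCascade_visc_mixedDrainPair {u v ε₀ : ℝ} (hu : 0 < |u|) (hu1 : |u| ≤ 1) (hv : 0 < |v|)
    (hv1 : |v| ≤ 1) (hε : 0 < ε₀) {X₀ : Fin 4 → ℝ}
    (hNG : NoGlobalCascade ε₀ (fun (i₁ i₂ i₃ : Fin 4) (μ : ℤ × ℤ × ℤ) => if μ = ((0 : ℤ), (0 : ℤ), (1 : ℤ)) then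
        (if (i₁ = 0 ∧ i₂ = 1) ∨ (i₁ = 1 ∧ i₂ = 0) then (if i₃ = 0 then u else if i₃ = 1 then v else 0) else 0)
      else if μ = ((1 : ℤ), (0 : ℤ), (0 : ℤ)) then
        (if i₁ = 0 ∧ i₂ = 1 ∧ i₃ = 0 then -u else if i₁ = 1 ∧ i₂ = 1 ∧ i₃ = 0 then -v else 0)
      else if μ = ((0 : ℤ), (1 : ℤ), (0 : ℤ)) then
        (if i₁ = 1 ∧ i₂ = 0 ∧ i₃ = 0 then -u else if i₁ = 1 ∧ i₂ = 1 ∧ i₃ = 0 then -v else 0) else 0) X₀) :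
    ∃ κ : ℝ, 0 < κ ∧ ∀ visc : ℝ, 0 < visc → visc * Real.sqrt 2 ≤ κ →
      ∃ (T : ℝ) (X : Fin 4 → ℤ → ℝ → ℝ), 0 < T ∧
        (∀ i n, X i n 0 = if n = 0 then X₀ i else 0) ∧ (∀ i n t, n < 0 → X i n t = 0) ∧
        (∀ i k, ∀ τ ∈ Ico (0 : ℝ) T, HasDerivWithinAt (X i k) (quadTerm ε₀ (fun (i₁ i₂ i₃ : Fin 4) (μ : ℤ × ℤ × ℤ) => if μ = ((0 : ℤ), (0 : ℤ), (1 : ℤ)) then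
        (if (i₁ = 0 ∧ i₂ = 1) ∨ (i₁ = 1 ∧ i₂ = 0) then (if i₃ = 0 then u else if i₃ = 1 then v else 0) else 0)
      else if μ = ((1 : ℤ), (0 : ℤ), (0 : ℤ)) then
        (if i₁ = 0 ∧ i₂ = 1 ∧ i₃ = 0 then -u else if i₁ = 1 ∧ i₂ = 1 ∧ i₃ = 0 then -v else 0)
      else if μ = ((0 : ℤ), (1 : ℤ), (0 : ℤ)) then
        (if i₁ = 1 ∧ i₂ = 0 ∧ i₃ = 0 then -u else if i₁ = 1 ∧ i₂ = 1 ∧ i₃ = 0 then -v else 0) else 0) X i k τ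
          - visc * (1 + ε₀) ^ ((2 : ℝ) * k) * X i k τ) (Ici 0) τ) ∧
        ∀ W σ : ℝ, 0 < σ → (1 + ε₀) * (bigLam ε₀ * σ) ^ 2 < 1 →
          ∃ (k : ℕ) (t : ℝ), 1 ≤ k ∧ 0 ≤ t ∧ t < T ∧ W * σ ^ k < ∫ s in (0 : ℝ)..t, X 1 k s ^ 2 := by
  have hvne : v ≠ 0 := abs_pos.1 hv
  have hL : 0 < bigLam ε₀ := bigLam_pos (by linarith)
  have hc := isCancellingCoeff_mixedDrainPair u v
  -- `M(u,v) ∈ E₂(R)` with `R = max |u|⁻¹ |v|⁻¹`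
  have hα : InTableClass (max |u|⁻¹ |v|⁻¹) (fun (i₁ i₂ i₃ : Fin 4) (μ : ℤ × ℤ × ℤ) => if μ = ((0 : ℤ), (0 : ℤ), (1 : ℤ)) then
        (if (i₁ = 0 ∧ i₂ = 1) ∨ (i₁ = 1 ∧ i₂ = 0) then (if i₃ = 0 then u else if i₃ = 1 then v else 0) else 0)
      else if μ = ((1 : ℤ), (0 : ℤ), (0 : ℤ)) then
        (if i₁ = 0 ∧ i₂ = 1 ∧ i₃ = 0 then -u else if i₁ = 1 ∧ i₂ = 1 ∧ i₃ = 0 then -v else 0)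
      else if μ = ((0 : ℤ), (1 : ℤ), (0 : ℤ)) then
        (if i₁ = 1 ∧ i₂ = 0 ∧ i₃ = 0 then -u else if i₁ = 1 ∧ i₂ = 1 ∧ i₃ = 0 then -v else 0) else 0) := by
    refine inTableClass_mixedDrainPair ?_ hu1 ?_ hv1
    · calc (max |u|⁻¹ |v|⁻¹)⁻¹ ≤ (|u|⁻¹)⁻¹ := inv_anti₀ (inv_pos.2 hu) (le_max_left _ _)
        _ = |u| := inv_inv |u|
    · calc (max |u|⁻¹ |v|⁻¹)⁻¹ ≤ (|v|⁻¹)⁻¹ := inv_anti₀ (inv_pos.2 hv) (le_max_right _ _)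
        _ = |v| := inv_inv |v|
  obtain ⟨κ, hκ, H⟩ := maximalViscousFlow_of_noGlobalCascade hε hα hNG
  refine ⟨κ, hκ, fun visc hvisc hvk => ?_⟩
  obtain ⟨T, X, hT, h1, h2, h3, h4, h5, h6⟩ := H visc hvisc.le hvk
  have hder : ∀ i k, ∀ τ ∈ Ico (0 : ℝ) T,
      HasDerivWithinAt (X i k) (quadTerm ε₀ (fun (i₁ i₂ i₃ : Fin 4) (μ : ℤ × ℤ × ℤ) => if μ = ((0 : ℤ), (0 : ℤ), (1 : ℤ)) then
        (if (i₁ = 0 ∧ i₂ = 1) ∨ (i₁ = 1 ∧ i₂ = 0) then (if i₃ = 0 then u else if i₃ = 1 then v else 0) else 0)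
      else if μ = ((1 : ℤ), (0 : ℤ), (0 : ℤ)) then
        (if i₁ = 0 ∧ i₂ = 1 ∧ i₃ = 0 then -u else if i₁ = 1 ∧ i₂ = 1 ∧ i₃ = 0 then -v else 0)
      else if μ = ((0 : ℤ), (1 : ℤ), (0 : ℤ)) then
        (if i₁ = 1 ∧ i₂ = 0 ∧ i₃ = 0 then -u else if i₁ = 1 ∧ i₂ = 1 ∧ i₃ = 0 then -v else 0) else 0) X i k τ
        - visc * (1 + ε₀) ^ ((2 : ℝ) * k) * X i k τ) (Ici 0) τ := by
    intro i k τ hτ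
    have hd : DifferentiableWithinAt ℝ (X i k) (Ico 0 T) τ :=
      ((h1 i k).differentiableOn one_ne_zero) τ hτ
    have hd' : DifferentiableWithinAt ℝ (X i k) (Ici 0) τ :=
      hd.mono_of_mem_nhdsWithin (by
        rw [mem_nhdsWithin]
        exact ⟨Iio T, isOpen_Iio, hτ.2, fun x hx => ⟨hx.2, hx.1⟩⟩)
    rw [← h4 i k τ hτ.1 hτ.2]
    exact hd'.hasDerivWithinAt
  have hreg : ∀ T' : ℝ, T' < T → ∃ M : ℝ, ∀ τ ∈ Icc (0 : ℝ) T', ∀ (i : Fin 4) (k : ℤ),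
      (1 + (1 + ε₀) ^ ((10 : ℝ) * k)) * |X i k τ| ≤ M := by
    intro T' hT'
    rcases le_or_gt T' 0 with h0 | h0
    · obtain ⟨M, hM⟩ := h5 (T / 2) (by linarith) (by linarith)
      exact ⟨M, fun τ hτ i k => hM τ hτ.1 (by linarith [hτ.2]) i k⟩
    · obtain ⟨M, hM⟩ := h5 T' h0 hT'
      exact ⟨M, fun τ hτ i k => hM τ hτ.1 hτ.2 i k⟩
  refine ⟨T, X, hT, h2, h3, hder, fun W σ hσ hsub => ?_⟩
  by_contra hcon
  push Not at hcon
  -- the envelope constants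
  set ν' : ℝ := bigLam ε₀ * σ with hν'def
  have hν' : 0 < ν' := mul_pos hL hσ
  set c : ℝ := 2 * |u / v| * Real.sqrt (u ^ 2 + v ^ 2) with hcdef
  have hc0 : 0 ≤ c := by positivity
  set Wp : ℝ := max W 0 with hWpdef
  have hWp0 : 0 ≤ Wp := le_max_right _ _
  set E : ℝ := Real.sqrt (∑ i, X₀ i ^ 2) with hEdef
  have hE0 : 0 ≤ E := Real.sqrt_nonneg _
  set B : ℝ := c * Wp / ν' + E / ν' + E with hBdef
  have hB0 : 0 ≤ B := by positivity
  -- energy bound for the shells `j ≥ 0`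
  have hxE : ∀ (j : ℕ) (t : ℝ), 0 ≤ t → t < T → ‖shellVec X (j : ℤ) t‖ ≤ E := by
    intro j t ht0 htT
    have hsum := viscousPartialEnergy_le_datumEnergy hε hvisc.le hc hder h2 h3 hreg t ⟨ht0, htT⟩ j
    have hterm : ‖shellVec X (j : ℤ) t‖ ^ 2 ≤ ∑ k ∈ Finset.range (j + 1), ‖shellVec X (k : ℤ) t‖ ^ 2 :=
      Finset.single_le_sum (f := fun k : ℕ => ‖shellVec X (k : ℤ) t‖ ^ 2) (fun k _ => sq_nonneg _)
        (Finset.self_mem_range_succ j)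
    rw [hEdef, ← Real.sqrt_sq (norm_nonneg (shellVec X (j : ℤ) t))]
    exact Real.sqrt_le_sqrt (hterm.trans hsum)
  -- the wake envelope gives the amplitude ceiling `‖x_j‖ ≤ B ν'^j`
  have hamp : ∀ (j : ℤ) (t : ℝ), 0 ≤ t → t < T → ‖shellVec X j t‖ ≤ B * ν' ^ j := by
    intro j t ht0 htT
    have hνj : 0 < ν' ^ j := zpow_pos hν' j
    rcases lt_or_ge j 0 with hj | hj
    · have : shellVec X j t = 0 := by
        ext i; simp [shellVec, h3 i j t hj]
      rw [this, norm_zero]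
      positivity
    rcases lt_or_ge j 2 with hj2 | hj2
    · interval_cases j
      · have h := hxE 0 t ht0 htT
        simp only [Nat.cast_zero] at h
        rw [zpow_zero, mul_one]
        calc ‖shellVec X 0 t‖ ≤ E := h
          _ ≤ B := by
            rw [hBdef]
            have : 0 ≤ c * Wp / ν' + E / ν' := by positivity
            linarith
      · have h := hxE 1 t ht0 htT
        simp only [Nat.cast_one] at h
        rw [zpow_one]
        calc ‖shellVec X 1 t‖ ≤ E := h
          _ = E / ν' * ν' := by field_simp
          _ ≤ B * ν' := by
            refine mul_le_mul_of_nonneg_right ?_ hν'.le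
            rw [hBdef]
            have : 0 ≤ c * Wp / ν' := by positivity
            linarith
    · -- `j = k + 1` with `k ≥ 1`: the viscous transmission law and the wake envelope
      obtain ⟨k, hk⟩ : ∃ k : ℕ, (k : ℤ) = j - 1 := ⟨(j - 1).toNat, Int.toNat_of_nonneg (by omega)⟩
      have hk1 : 1 ≤ k := by omega
      have hj' : j = (k : ℤ) + 1 := by omega
      subst hj'
      have hx := norm_shellVec_succ_le_wakeIntegral_visc_mixedDrainPair hvne hε hvisc.le hder h2 h3 hreg hk1
        ⟨ht0, htT⟩
      have hwake : ∫ s in (0 : ℝ)..t, X 1 k s ^ 2 ≤ Wp * σ ^ k :=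
        (hcon k t hk1 ht0 htT).trans (mul_le_mul_of_nonneg_right (le_max_left _ _) (pow_nonneg hσ.le _))
      have hΛk : bigLam ε₀ ^ ((k : ℤ)) = bigLam ε₀ ^ k := zpow_natCast _ _
      have hνk : ν' ^ ((k : ℤ) + 1) = ν' ^ k * ν' := by
        rw [zpow_add_one₀ hν'.ne', zpow_natCast]
      rw [hνk]
      calc ‖shellVec X ((k : ℤ) + 1) t‖
          ≤ 2 * |u / v| * Real.sqrt (u ^ 2 + v ^ 2) * bigLam ε₀ ^ (k : ℤ) * ∫ s in (0 : ℝ)..t, X 1 k s ^ 2 := hx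
        _ ≤ 2 * |u / v| * Real.sqrt (u ^ 2 + v ^ 2) * bigLam ε₀ ^ (k : ℤ) * (Wp * σ ^ k) :=
            mul_le_mul_of_nonneg_left hwake (by rw [hΛk]; positivity)
        _ = c * Wp / ν' * (ν' ^ k * ν') := by
            rw [hΛk, hν'def, mul_pow, hcdef]
            field_simp
        _ ≤ B * (ν' ^ k * ν') := by
            refine mul_le_mul_of_nonneg_right ?_ (by positivity)
            rw [hBdef]
            have : 0 ≤ E / ν' + E := by positivity
            linarith
  obtain ⟨M, hM⟩ := weight45_bounded_of_subcriticalCeiling hε hvisc hc h1 h2 h3 h4 hν' hsub hamp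
  obtain ⟨t, ht0, htT, i, n, hlt⟩ := h6 M
  exact absurd (hM t ht0 htT i n) (not_le.2 hlt)

end BlowupRigidityOne

end Summit.NavierStokesRegularity.NavierStokesRegularity.Theorems

end
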